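import Summits.FinalStateConjecture.FinalStateConjecture.Theorems.BondiDrainDispersalHorizonlessMustDrainNoHorizonOfFutureNullComplete
import Summits.FinalStateConjecture.FinalStateConjecture.Theorems.BondiDrainDispersalHorizonlessMustDrainScriCompleteOfFutureNullComplete
import HarnessLib

/-!
# Route BondiDrainDispersal · crux `HorizonlessMustDrain` (stmt-FinalStateConjecture-9976), line `registered`:
# the incomplete sector is vacuum DYNAMICS — statement C forces "future null complete ⇒ future timelike complete"

Helper file of the crux `Theses.BondiDrainDispersal.HorizonlessMustDrain` (`--supports stmt-FinalStateConjecture-9976`;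
lead c7, 2026-08-17).  The registered skeleton (Lines/birth.lean) is the equivalence
`crux ↔ stub_completeSector ∧ stub_incompleteSector`; the incomplete sector is expected to hold VACUOUSLY through statement C
of the line ("complete `𝓘⁺` (sojourn form) + no ray-theoretic event horizon ⇒ future causally geodesically complete", the
composite `Sig.horizonlessComplete`; sufficient unprinted fact (★) `Sig.visibleIncompleteIsNaked`, p161294).  The two landed
logic-tier stubs W3 `stub_noHorizon_of_futureNullComplete` (p156437) and W6 `stub_scriComplete_of_futureNullComplete` (p156711)
say that, on EVERY Cauchy development, both hypotheses of C are consequences of future NULL geodesic completeness alone.  Hence: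

* `stub_timelikeComplete_of_nullComplete_of_C` — **C implies: a future null geodesically complete maximal vacuum Cauchy
  development of an admissible datum is future timelike geodesically complete** ("no singularity at `i⁺`"), a global statement
  about the vacuum Einstein flow;
* `stub_timelikeComplete_of_nullComplete_of_cauchyC` — **the same statement C read over ALL Cauchy developments of admissible
  data (vacuum equations and maximality dropped) implies: every future null geodesically complete Cauchy development of an
  admissible datum is future timelike geodesically complete.**  That conclusion is FALSE: Geroch's example (Geroch 1968b, quoted
  in Hawking–Ellis 1973, §8.1, p. 258) — Minkowski space conformally rescaled, `ĝ = Ω² η` with `Ω = 1` outside the world-tube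
  `{|x| ≤ 1}` (and, to make it a development of the TRIVIAL admissible datum `(ℝ³, δ, 0)`, also for `t ≤ 2`), `Ω` symmetric
  about the `t`-axis and `t² Ω → 0` along it — has the causal structure and the Cauchy surfaces of Minkowski space, every null
  geodesic leaves the tube and is complete, and the `t`-axis is a timelike geodesic of finite proper time.  So C cannot be a
  theorem of Lorentzian causal geometry plus asymptotic flatness: any proof of the incomplete sector by emptiness must use
  `VacuumCauchyDevelopment.isRicciFlat` / `IsMaximal` as dynamics (consistent with the fibrewise form p164607: every VACUUM MGHD
  of the trivial datum is future causally complete).  The construction of Geroch's development over `CauchyDevelopment` is not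
  in the tree; it is the natural witness item for the second implication's antecedent being false.

Everything is proved (pure logic over W3/W6); no definition and no named fact is introduced (C and its Cauchy-development
reading are written out in full as hypotheses).
References: Hawking–Ellis 1973, §8.1, p. 258 (Geroch's example; kinds of g-incompleteness); R. Geroch, *What is a singularity
in general relativity?*, Ann. Phys. 48 (1968) 526–540; O'Neill 1983, Ch. 14, p. 435.
-/

set_option linter.dupNamespace false

noncomputable section

open scoped Manifold ContDiff Topology
open Set Function Literature.Geometry.Lorentzian

namespace Summit.FinalStateConjecture.FinalStateConjecture.Theorems.BondiDrainDispersalHorizonlessMustDrain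

/-- **Statement C makes "future null complete ⇒ future timelike complete" a theorem about vacuum MGHDs** (registered glue stub,
lead c7).  If every maximal vacuum Cauchy development of an admissible datum with complete `𝓘⁺` (sojourn form) and no event
horizon (typed ray-theoretic clause) is future causally geodesically complete (statement C of line `birth`, verbatim
`Sig.horizonlessComplete`), then every future NULL geodesically complete maximal vacuum Cauchy development of an admissible
datum is future TIMELIKE geodesically complete — because future null completeness already gives complete `𝓘⁺`
(`stub_scriComplete_of_futureNullComplete`, W6) and the no-horizon clause (`stub_noHorizon_of_futureNullComplete`, W3).
Hawking–Ellis 1973, §8.1 (the three kinds of g-incompleteness are logically independent in general, Geroch 1968b, p. 258), so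
the conclusion is a genuine dynamical statement about the Einstein vacuum flow. [cite: HawkingEllis1973, §8.1, p. 258] -/
theorem stub_timelikeComplete_of_nullComplete_of_C : open scoped Manifold in (∀ (X : Type) [TopologicalSpace X] [ChartedSpace Literature.Geometry.Lorentzian.E3 X] [IsManifold (𝓡 3) ((⊤ : ℕ∞) : WithTop ℕ∞) X] [T2Space X] [SecondCountableTopology X] [ConnectedSpace X], ∀ D ∈ Literature.Geometry.Lorentzian.admissibleVacuumData X, ∀ 𝒟 : Literature.Geometry.Lorentzian.VacuumCauchyDevelopment D, 𝒟.IsMaximal → Summit.FinalStateConjecture.HasCompleteNullInfinity 𝒟.toCauchyDevelopment → ¬ (∀ [𝒟.metric.HasLeviCivita], ∃ q : 𝒟.carrier, ∀ (p : X) (γ : ℝ → 𝒟.carrier) (dom : Set ℝ), 𝒟.metric.IsNormalisedNullRayFrom 𝒟.timeOrientation 𝒟.embed 𝒟.normal p γ dom → ¬ BddAbove dom → q ∉ 𝒟.metric.chronologicalPast 𝒟.timeOrientation (γ '' (dom ∩ Set.Ici 0))) → ∀ [𝒟.metric.HasLeviCivita], ¬ 𝒟.metric.IsFutureNullGeodesicallyIncomplete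 𝒟.timeOrientation ∧ ¬ 𝒟.metric.IsFutureTimelikeGeodesicallyIncomplete 𝒟.timeOrientation) → ∀ (X : Type) [TopologicalSpace X] [ChartedSpace Literature.Geometry.Lorentzian.E3 X] [IsManifold (𝓡 3) ((⊤ : ℕ∞) : WithTop ℕ∞) X] [T2Space X] [SecondCountableTopology X] [ConnectedSpace X], ∀ D ∈ Literature.Geometry.Lorentzian.admissibleVacuumData X, ∀ 𝒟 : Literature.Geometry.Lorentzian.VacuumCauchyDevelopment D, 𝒟.IsMaximal → (∀ [𝒟.metric.HasLeviCivita], ¬ 𝒟.metric.IsFutureNullGeodesicallyIncomplete 𝒟.timeOrientation) → ∀ [𝒟.metric.HasLeviCivita], ¬ 𝒟.metric.IsFutureTimelikeGeodesicallyIncomplete 𝒟.timeOrientation := by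
  intro hC X _ _ _ _ _ _ D hD 𝒟 hmax hN _
  have hscri : Summit.FinalStateConjecture.HasCompleteNullInfinity 𝒟.toCauchyDevelopment :=
    stub_scriComplete_of_futureNullComplete X D 𝒟.toCauchyDevelopment hN
  have hH := stub_noHorizon_of_futureNullComplete X D 𝒟.toCauchyDevelopment hN
  exact (hC X D hD 𝒟 hmax hscri hH).2

/-- **Statement C read over ALL Cauchy developments forces "future null complete ⇒ future timelike complete" for every Cauchy
development of an admissible datum** (registered glue stub, lead c7) — and that conclusion is false in Lorentzian geometry:
Geroch's conformally rescaled Minkowski space `Ω² η`, `Ω = 1` off the world-tube `{|x| ≤ 1}` and for `t ≤ 2`, `Ω(t, x) = Ω(t, −x)`,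
`t² Ω → 0` along the `t`-axis (Geroch 1968b; Hawking–Ellis 1973, §8.1, p. 258), is a Cauchy development of the trivial
admissible datum `(ℝ³, δ, 0)` with the causal structure of Minkowski space, null (and spacelike) geodesically complete, whose
`t`-axis is a future-incomplete timelike geodesic.  Hence the hypothesis — C with `VacuumCauchyDevelopment … IsMaximal` weakened
to `CauchyDevelopment` — is false, i.e. the emptiness of the crux's incomplete sector can only come from the vacuum equations /
maximality, not from causal theory and asymptotic flatness.  (The tree does not yet construct Geroch's development; this
implication isolates it as the witness to build.) [cite: HawkingEllis1973, §8.1, p. 258] -/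
theorem stub_timelikeComplete_of_nullComplete_of_cauchyC : open scoped Manifold in (∀ (X : Type) [TopologicalSpace X] [ChartedSpace Literature.Geometry.Lorentzian.E3 X] [IsManifold (𝓡 3) ((⊤ : ℕ∞) : WithTop ℕ∞) X] [T2Space X] [SecondCountableTopology X] [ConnectedSpace X], ∀ D ∈ Literature.Geometry.Lorentzian.admissibleVacuumData X, ∀ 𝒟 : Literature.Geometry.Lorentzian.CauchyDevelopment D, Summit.FinalStateConjecture.HasCompleteNullInfinity 𝒟 → ¬ (∀ [𝒟.metric.HasLeviCivita], ∃ q : 𝒟.carrier, ∀ (p : X) (γ : ℝ → 𝒟.carrier) (dom : Set ℝ), 𝒟.metric.IsNormalisedNullRayFrom 𝒟.timeOrientation 𝒟.embed 𝒟.normal p γ dom → ¬ BddAbove dom → q ∉ 𝒟.metric.chronologicalPast 𝒟.timeOrientation (γ '' (dom ∩ Set.Ici 0))) → ∀ [𝒟.metric.HasLeviCivita], ¬ 𝒟.metric.IsFutureNullGeodesicallyIncomplete 𝒟.timeOrientation ∧ ¬ 𝒟.metric.IsFutureTimelikeGeodesicallyIncomplete 𝒟.timeOrientation) → ∀ (X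 : Type) [TopologicalSpace X] [ChartedSpace Literature.Geometry.Lorentzian.E3 X] [IsManifold (𝓡 3) ((⊤ : ℕ∞) : WithTop ℕ∞) X] [T2Space X] [SecondCountableTopology X] [ConnectedSpace X], ∀ D ∈ Literature.Geometry.Lorentzian.admissibleVacuumData X, ∀ 𝒟 : Literature.Geometry.Lorentzian.CauchyDevelopment D, (∀ [𝒟.metric.HasLeviCivita], ¬ 𝒟.metric.IsFutureNullGeodesicallyIncomplete 𝒟.timeOrientation) → ∀ [𝒟.metric.HasLeviCivita], ¬ 𝒟.metric.IsFutureTimelikeGeodesicallyIncomplete 𝒟.timeOrientation := by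
  intro hC X _ _ _ _ _ _ D hD 𝒟 hN _
  have hscri : Summit.FinalStateConjecture.HasCompleteNullInfinity 𝒟 :=
    stub_scriComplete_of_futureNullComplete X D 𝒟 hN
  have hH := stub_noHorizon_of_futureNullComplete X D 𝒟 hN
  exact (hC X D hD 𝒟 hscri hH).2

end Summit.FinalStateConjecture.FinalStateConjecture.Theorems.BondiDrainDispersalHorizonlessMustDrain

end
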